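import Summits.RiemannHypothesis.RiemannHypothesis.Theses.WeilWindowFlow
import Literature.NumberTheory.LFunctions.WeilGroundState
import Literature.NumberTheory.LFunctions.WeilSemilocalCompactness
import Literature.NumberTheory.DiophantineGeometry.NamedHypothesesRHProofs

/-!
# Sketch — crux-ideate ideator 1, crux `DerivLeakage` (stmt-RiemannHypothesis-14754), round 1

First lemmas (typed, elaborating) for the two idea cards of this seat:

* Card `plunge-height-localisation`: split the explicit formula AT THE GROUND STATE at a height `T`:
  `ε(a) = L_T(u_a) + H_T(u_a)`. The crux follows from (S_low) `0 ≤ L_T(u_a)` (the ONLY RH-content,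
  carried by the finitely many zeros below `T`; a consequence of `RiemannHypothesisUpTo T`, proved
  here: `lowBlockNonnegOn_of_rhUpTo`) and (S_tail) "Hadamard–Tauberian saturation": the leakage rate is
  dominated by the HIGH block, `-ε'(a) ≤ K₁ · H_T(u_a)` (RH-free in form), via `derivLeakage_of_plungeSplit`
  (proved glue). `HadamardTailLaw` records the Tauberian identity `T · H_T(u_a) → −ε'(a)/κ'`.
* Card `natural-projection-frame-bound`: project every zero onto the critical line; the resulting form
  `Q♮` is positive semidefinite unconditionally, equals `Re Q` under RH, and its window bottom `ε♮(a)`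
  is the lower frame (sampling) bound of the zeta ordinates on `L²(−a, a)`. Calibration target:
  `DerivLeakage ↔ RH ∧ DerivLeakage♮` (modulo `WindowLipschitz` for `→`); typed here:
  `weilNaturalPartial`, `weilQuadraticNatural`, `weilGroundEnergyNatural`, `DerivLeakageNatural`,
  `NaturalAgreesUnderRH`, `derivLeakage_of_rh_of_natural` (proved from `NaturalAgreesUnderRH`).
-/

noncomputable section

set_option linter.dupNamespace false

open Set Filter Topology MeasureTheory Complex
open scoped ComplexConjugate

namespace Summit.RiemannHypothesis.RiemannHypothesis.Cruxes.DerivLeakage.SketchIdeator1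

open _root_.Literature.NumberTheory.LFunctions
open _root_.Literature.NumberTheory.DiophantineGeometry
open _root_.Summit.RiemannHypothesis.RiemannHypothesis.Theses

/-! ## Card 1 — plunge-height localisation -/

/-- Low block of the explicit formula at `u`, height `T`:
`L_T(u) = Σ_{ρ ∈ weilZeroIndex T} m(ρ) · Re( û(ρ) · conj û(1 − conj ρ) )` — a genuine finite sum
(`weilZeroIndex_finite`); `û = weilMellin u` is entire for a ground state
(`IsWeilGroundState.differentiable_weilMellin`). -/
def lowBlock (T : ℝ) (u : ℝ → ℂ) : ℝ :=
  ∑ᶠ ρ ∈ weilZeroIndex T,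
    (riemannZetaZeroOrder ρ : ℝ) * (weilMellin u ρ * conj (weilMellin u (1 - conj ρ))).re

/-- High block at a ground state of the window `a`: `H_T(u) := ε(a) − L_T(u)` (the explicit formula
at the ground state, `ε(a) = Q̄(u_a) = lim_T Σ_{|Im ρ| ≤ T} …`, makes this the tail over `|Im ρ| > T`). -/
def highBlock (a T : ℝ) (u : ℝ → ℂ) : ℝ :=
  weilGroundEnergy a - lowBlock T u

/-- (S_low) The finite low block is non-negative at every ground state of every window of the range.
This is where ALL the RH-content of the crux sits (`lowBlockNonnegOn_of_rhUpTo`). -/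
def LowBlockNonnegOn (b₀ A T : ℝ) : Prop :=
  ∀ a : ℝ, b₀ ≤ a → a ≤ A → ∀ u : ℝ → ℂ, IsWeilGroundState a u → 0 ≤ lowBlock T u

/-- (S_tail) Hadamard–Tauberian saturation on the range: at positive differentiability points the
leakage rate is dominated by the HIGH block of the explicit formula at any ground state,
`−ε'(a) ≤ K₁ · H_T(u_a)`. Mechanism: `−ε'(a) = κ · c(a)²` (Hadamard; `c` = edge coefficient of `u_a`)
and `c(a)² = C₀ · lim_T T · H_T(u_a)` (Tauberian: the edge singularity IS the high-zero tail; every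
zero above `T` contributes `|F(γ)|² ≥ 0` to an edge-localised piece REGARDLESS of `Re ρ`, cross-edge
interference being Landau–Gonek sums), plus saturation of the tail from `T = T₁(b₀, A)` on. RH-free
in form; `K₁ ≍ T₁ ≍ e^{2A}` is the honest size of the crux's constant. -/
def TailDominatesDerivOn (b₀ A T K₁ : ℝ) : Prop :=
  ∀ a : ℝ, b₀ ≤ a → a ≤ A → 0 < weilGroundEnergy a → DifferentiableAt ℝ weilGroundEnergy a →
    ∀ u : ℝ → ℂ, IsWeilGroundState a u → -deriv weilGroundEnergy a ≤ K₁ * highBlock a T u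

/-- The Hadamard–Tauberian identity (RH-free claim of the card): WINDOW-DERIVATIVE = RENORMALISED
HIGH-ZERO TAIL, `T · H_T(u_a) → −ε'(a)/κ'` as `T → ∞`, one universal `κ' > 0`. -/
def HadamardTailLaw (κ' : ℝ) : Prop :=
  0 < κ' ∧ ∀ a : ℝ, 0 < a → DifferentiableAt ℝ weilGroundEnergy a → ∀ u : ℝ → ℂ,
    IsWeilGroundState a u →
      Tendsto (fun T : ℝ ↦ T * highBlock a T u) atTop (𝓝 (-deriv weilGroundEnergy a / κ'))

/-- The split, range by range: a height `T = T₁(b₀, A)` and a constant `K₁ ≥ 0` with (S_low) and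
(S_tail). -/
def PlungeSplit : Prop :=
  ∀ b₀ A : ℝ, 0 < b₀ → b₀ ≤ A →
    ∃ T K₁ : ℝ, 0 ≤ K₁ ∧ LowBlockNonnegOn b₀ A T ∧ TailDominatesDerivOn b₀ A T K₁

/-- GLUE (proved): ground states exist (`ConnesConsaniMoscovici2025_thm_3_6_holds.exists_isWeilGroundState`
in the tree) and the split give the crux, with `K = K₁`. -/
theorem derivLeakage_of_plungeSplit (hex : ∀ a : ℝ, 0 < a → ∃ u : ℝ → ℂ, IsWeilGroundState a u)
    (h : PlungeSplit) : WeilWindowFlow.DerivLeakage := by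
  intro b₀ A hb₀ hA
  obtain ⟨T, K₁, hK₁, hlow, htail⟩ := h b₀ A hb₀ hA
  refine ⟨K₁, fun a ha hA' hpos hdiff ↦ ?_⟩
  obtain ⟨u, hu⟩ := hex a (hb₀.trans_le ha)
  have h1 := htail a ha hA' hpos hdiff u hu
  have h2 := hlow a ha hA' u hu
  have h3 : highBlock a T u ≤ weilGroundEnergy a := by
    unfold highBlock; linarith
  exact h1.trans (mul_le_mul_of_nonneg_left h3 hK₁)

/-- Under RH up to height `T`, every `ρ ∈ weilZeroIndex T` lies on the critical line. -/
theorem re_eq_half_of_mem_weilZeroIndex {T : ℝ} (hT : RiemannHypothesisUpTo T) {ρ : ℂ}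
    (hρ : ρ ∈ weilZeroIndex T) : ρ.re = 1 / 2 := by
  obtain ⟨h0, -, -, h3, h4⟩ := hρ
  rcases lt_or_gt_of_ne h3 with hneg | hpos
  · exact hT.re_eq_of_im_neg h0 hneg ((neg_le_abs _).trans h4)
  · exact hT ρ h0 hpos ((le_abs_self _).trans h4)

/-- (S_low) from RH up to height `T` (proved): on the line `1 − conj ρ = ρ`, so each term of the low
block is `m(ρ) · |û(ρ)|² ≥ 0`. With `riemannHypothesisUpTo_platt_trudgian` (`T = 3·10¹²`) this settles
the low block on every range whose saturation height is below `3·10¹²`; with RH, on every range. -/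
theorem lowBlockNonnegOn_of_rhUpTo {b₀ A T : ℝ} (hT : RiemannHypothesisUpTo T) :
    LowBlockNonnegOn b₀ A T := by
  intro a _ _ u _
  unfold lowBlock
  refine finsum_nonneg fun ρ ↦ finsum_nonneg fun hρ ↦ ?_
  have hre : ρ.re = 1 / 2 := re_eq_half_of_mem_weilZeroIndex hT hρ
  have hρ1 : ρ ≠ 1 := by
    intro h; obtain ⟨-, -, -, h3, -⟩ := hρ; simp [h] at h3
  have hfix : 1 - conj ρ = ρ := by
    apply Complex.ext
    · simp [hre]; norm_num
    · simp
  rw [hfix, Complex.mul_conj, Complex.ofReal_re]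
  have hm : (0 : ℝ) ≤ (riemannZetaZeroOrder ρ : ℝ) := by
    exact_mod_cast riemannZetaZeroOrder_nonneg hρ1
  exact mul_nonneg hm (Complex.normSq_nonneg _)

/-! ## Card 2 — natural projection `Q♮`, the lower frame bound of the ordinates -/

/-- Truncated natural form: `Σ_{ρ ∈ weilZeroIndex T} m(ρ) |ĝ(1/2 + iγ)|²`, every zero projected onto
the critical line (ordinates only). Non-negative and non-decreasing in `T` by construction. -/
def weilNaturalPartial (g : ℝ → ℂ) (T : ℝ) : ℝ :=
  ∑ᶠ ρ ∈ weilZeroIndex T,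
    (riemannZetaZeroOrder ρ : ℝ) * ‖weilMellin g (1 / 2 + (ρ.im : ℂ) * I)‖ ^ 2

/-- The natural (critical-line projected) Weil form `Q♮(g) := sup_T Σ_{|γ| ≤ T} m(ρ)|ĝ(1/2+iγ)|²`
(= the limit; for test `g`, `|ĝ(1/2+iγ)|² ≪ γ⁻⁴` and `N(T) ≪ T log T`, so the supremum is finite).
PSD unconditionally; `= Re Q(g)` under RH (`NaturalAgreesUnderRH`). For `g` in the window,
`Q♮(g)/‖g‖²` bounded below by the LOWER FRAME BOUND of `{e^{iγt}}` (with multiplicity) on `L²(−a,a)`. -/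
def weilQuadraticNatural (g : ℝ → ℂ) : ℝ :=
  ⨆ T : ℝ, weilNaturalPartial g T

/-- The natural window bottom `ε♮(a)` (same `sInf` shape as `weilGroundEnergy`). -/
def weilGroundEnergyNatural (a : ℝ) : ℝ :=
  sInf {x : ℝ | ∃ g : ℝ → ℂ, IsWeilTest g ∧ tsupport g ⊆ Icc (-a) a ∧
    ∫ t : ℝ, ‖g t‖ ^ 2 = 1 ∧ x = weilQuadraticNatural g}

/-- `DerivLeakage♮`: the crux verbatim for the natural bottom — an RH-FREE statement (ordinates only):
the lower frame bound of the zeta ordinates on `[−a, a]` decays at a locally bounded relative rate. -/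
def DerivLeakageNatural : Prop :=
  ∀ b₀ A : ℝ, 0 < b₀ → b₀ ≤ A → ∃ K : ℝ, ∀ a : ℝ, b₀ ≤ a → a ≤ A →
    0 < weilGroundEnergyNatural a → DifferentiableAt ℝ weilGroundEnergyNatural a →
      -deriv weilGroundEnergyNatural a ≤ K * weilGroundEnergyNatural a

/-- Under RH the natural bottom IS the window bottom (explicit formula `explicit_formula_holds` at
`k = g ⋆ g̃`: on the line `k̂(ρ) = |ĝ(ρ)|²`, so `weilZeroSidePartial k T = weilNaturalPartial g T`,
and the monotone limit is `Re W(k) = Re Q(g)`). Provable now (size M). -/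
def NaturalAgreesUnderRH : Prop :=
  RiemannHypothesis → ∀ a : ℝ, 0 < a → weilGroundEnergyNatural a = weilGroundEnergy a

/-- Calibration, easy half (proved from `NaturalAgreesUnderRH`): `RH ∧ DerivLeakage♮ → DerivLeakage`.
(The other half, `DerivLeakage → RH`, is the disprover's calibration modulo `WindowLipschitz`; and
`RH → (DerivLeakage ↔ DerivLeakage♮)` by the same agreement.) -/
theorem derivLeakage_of_rh_of_natural (hagree : NaturalAgreesUnderRH) (hRH : RiemannHypothesis)
    (hN : DerivLeakageNatural) : WeilWindowFlow.DerivLeakage := by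
  intro b₀ A hb₀ hA
  obtain ⟨K, hK⟩ := hN b₀ A hb₀ hA
  refine ⟨K, fun a ha hA' hpos hdiff ↦ ?_⟩
  have ha0 : 0 < a := hb₀.trans_le ha
  -- the two bottoms agree on a neighbourhood of `a` (all windows `> 0`), hence have the same derivative
  have heq : weilGroundEnergyNatural =ᶠ[𝓝 a] weilGroundEnergy := by
    filter_upwards [Ioi_mem_nhds ha0] with b hb using hagree hRH b hb
  have hpos' : 0 < weilGroundEnergyNatural a := by rwa [hagree hRH a ha0]
  have hdiff' : DifferentiableAt ℝ weilGroundEnergyNatural a := heq.differentiableAt_iff.2 hdiff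
  have h := hK a ha hA' hpos' hdiff'
  rwa [heq.deriv_eq, hagree hRH a ha0] at h

end Summit.RiemannHypothesis.RiemannHypothesis.Cruxes.DerivLeakage.SketchIdeator1
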